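import Literature.Geometry.ComplexAnalytic.EvenQuarticWeierstrassBifurcation
import HarnessLib

/-!
# Critical zeros of `(u⁴ + λ₁u² + λ₂)·unit` on the two branches of `Σ(B₂)`: one double zero at `u = 0` on `λ₂ = 0`,
# a symmetric pair `±u₀` of double zeros on `4λ₂ = λ₁²` — with non-vanishing second derivative (AGZV II §5.2)

Family `hodge`, layer `Literature/Geometry/ComplexAnalytic`, sequel of `EvenQuarticWeierstrassBifurcation` (an even
holomorphic `f(μ, u)` of order four in `u` is `Q_μ(u)·U(μ, u)` with `Q_μ = u⁴ + λ₁(μ)u² + λ₂(μ) = F̂(·, λ(μ))` and `U`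
zero-free).  Written by the prover seat `hodge-nonav-19716-p2` (g8, cell `hodge-nonav`) for programme B2-BIF (the
bifurcation half `IsSymmetricA3Bifurcation` of the binder hB2 `picardLefschetz_symmetricA3` of crux K1-B,
`Summits/HodgeConjecture/HodgeConjecture/Theses/SignSymmetricPowers.lean`, stmt-HodgeConjecture-19716): the NODE COUNT of
the two singular members of the symmetric `A₃` unfolding ("`b = 0` has one node at `e_j`, `b = ψ(a)` two nodes exchanged
by the involution") and their NON-DEGENERACY (the second `u`-derivative of the reduced function — the Schur complement
of the eliminated block in the affine Hessian, `HodgeTheory/OrdinaryDoublePointSliceCriterion` — is non-zero) are read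
off the polynomial `F̂(·, λ)` of AGZV II §5.2:

* `eval_derivative_derivative_hatB₂` — `F̂'' = 12ŷ² + 2λ₁`;
* `critical_zero_iff_hatB₂` — on the polydisc, `f(μ, u) = 0 = ∂ᵤf(μ, u)` iff `F̂(u) = 0 = F̂'(u)` for `F̂ = F̂(·, λ(μ))`;
* `iteratedDeriv_two_eq_of_double_root` — at a double root `u₀` of a polynomial `Q`, a function `g = Q·V` (`V`
  holomorphic) has `g''(u₀) = Q''(u₀)·V(u₀)`;
* `critical_zeros_axis` — on the branch `λ₂(μ) = 0` with `∂ᵤ²f(μ, 0) ≠ 0`: `λ₁(μ) ≠ 0`, `4λ₂ ≠ λ₁²`, and the only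
  critical zero of `f(μ, ·)` in the disc is `u = 0` (AGZV II: the member `λ₂ = 0`, `λ₁ ≠ 0` of `B₂` has ONE critical
  point with critical value zero on the boundary);
* `critical_zeros_branch` — on the branch `4λ₂(μ) = λ₁(μ)²` with `λ₂(μ) ≠ 0`: the critical zeros of `f(μ, ·)` in the
  disc are exactly a pair `±u₀`, `u₀ ≠ 0` (`u₀² = -λ₁/2`), and `∂ᵤ²f(μ, ±u₀) ≠ 0` (the member `λ₁² = 4λ₂` has a PAIR of
  non-degenerate critical points exchanged by the involution).

## References
* [ArnoldGuseinzadeVarchenko2012] V. I. Arnold, S. M. Gusein-Zade, A. N. Varchenko, *Singularities of Differentiable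
  Maps, Volume 2*, Birkhäuser 2012, Part I §5.2 (pp. 132–133 of the held text, fig. 48).
-/

noncomputable section

open Polynomial Metric Set Filter Complex
open scoped Topology
open Literature.Analysis.Complex Literature.Analysis.Complex.SCV

namespace Literature.Geometry.ComplexAnalytic

namespace BoundarySingularity

/-- `F̂''(ŷ) = 12ŷ² + 2λ₁`. [cite: ArnoldGuseinzadeVarchenko2012, Part I §5.2 (held text chunk p0132)] -/
theorem eval_derivative_derivative_hatB₂ (l : Fin 2 → ℂ) (y : ℂ) :
    (derivative (derivative (hatB₂ l))).eval y = 12 * y ^ 2 + 2 * l 0 := by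
  simp [hatB₂]
  ring

/-- **Second derivative at a double root.**  If `g = Q·V` on an open set `s` with `Q` a polynomial and `V` holomorphic,
then at a double root `u₀ ∈ s` of `Q` (`Q(u₀) = Q'(u₀) = 0`): `g''(u₀) = Q''(u₀)·V(u₀)`. [folklore]
[cite: ArnoldGuseinzadeVarchenko2012, Part I §5.2] -/
theorem iteratedDeriv_two_eq_of_double_root {g V : ℂ → ℂ} {Q : ℂ[X]} {s : Set ℂ} (hs : IsOpen s)
    (hV : DifferentiableOn ℂ V s) (hg : ∀ u ∈ s, g u = Q.eval u * V u) {u₀ : ℂ} (hu₀ : u₀ ∈ s)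
    (hQ0 : Q.eval u₀ = 0) (hQ1 : (derivative Q).eval u₀ = 0) :
    iteratedDeriv 2 g u₀ = (derivative (derivative Q)).eval u₀ * V u₀ := by
  have hVan : AnalyticOnNhd ℂ V s := hV.analyticOnNhd hs
  have hV'd : DifferentiableOn ℂ (deriv V) s := (hVan.deriv).differentiableOn
  -- first derivative on `s`
  have h1 : ∀ u ∈ s, HasDerivAt g ((derivative Q).eval u * V u + Q.eval u * deriv V u) u := by
    intro u hu
    have hVu : HasDerivAt V (deriv V u) u := (hV.differentiableAt (hs.mem_nhds hu)).hasDerivAt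
    have h := (Q.hasDerivAt u).mul hVu
    refine h.congr_of_eventuallyEq ?_
    filter_upwards [hs.mem_nhds hu] with v hv
    exact hg v hv
  have h1' : deriv g =ᶠ[𝓝 u₀] fun u => (derivative Q).eval u * V u + Q.eval u * deriv V u := by
    filter_upwards [hs.mem_nhds hu₀] with u hu
    exact (h1 u hu).deriv
  -- second derivative at `u₀`
  have hVu₀ : HasDerivAt V (deriv V u₀) u₀ := (hV.differentiableAt (hs.mem_nhds hu₀)).hasDerivAt
  have hV'u₀ : HasDerivAt (deriv V) (deriv (deriv V) u₀) u₀ := (hV'd.differentiableAt (hs.mem_nhds hu₀)).hasDerivAt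
  have h2 : HasDerivAt (fun u => (derivative Q).eval u * V u + Q.eval u * deriv V u)
      ((derivative (derivative Q)).eval u₀ * V u₀ + (derivative Q).eval u₀ * deriv V u₀ +
        ((derivative Q).eval u₀ * deriv V u₀ + Q.eval u₀ * deriv (deriv V) u₀)) u₀ :=
    (((derivative Q).hasDerivAt u₀).mul hVu₀).add ((Q.hasDerivAt u₀).mul hV'u₀)
  rw [show (2 : ℕ) = 1 + 1 from rfl, iteratedDeriv_succ, iteratedDeriv_one, h1'.deriv_eq, h2.deriv, hQ0, hQ1]
  ring

variable {f : (ℂ × ℂ) × ℂ → ℂ} {ε ρ : ℝ} {l₁ l₂ : ℂ × ℂ → ℂ} {U : (ℂ × ℂ) × ℂ → ℂ}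

/-- **Critical zeros of `f(μ, ·)` are the critical zeros of `F̂(·, λ(μ))`** on the disc `|u| < ρ` (`U` zero-free).
[cite: ArnoldGuseinzadeVarchenko2012, Part I §5.2 (held text chunk p0132)] -/
theorem critical_zero_iff_hatB₂ (hUd : DifferentiableOn ℂ U (ball (0 : ℂ × ℂ) ε ×ˢ ball (0 : ℂ) ρ))
    (hUne : ∀ p ∈ ball (0 : ℂ × ℂ) ε ×ˢ ball (0 : ℂ) ρ, U p ≠ 0)
    (hfact : ∀ p ∈ ball (0 : ℂ × ℂ) ε ×ˢ ball (0 : ℂ) ρ, f p = (p.2 ^ 4 + l₁ p.1 * p.2 ^ 2 + l₂ p.1) * U p)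
    {μ : ℂ × ℂ} (hμ : μ ∈ ball (0 : ℂ × ℂ) ε) {u : ℂ} (hu : u ∈ ball (0 : ℂ) ρ) :
    (f (μ, u) = 0 ∧ deriv (fun u => f (μ, u)) u = 0) ↔
      ((hatB₂ ![l₁ μ, l₂ μ]).eval u = 0 ∧ (derivative (hatB₂ ![l₁ μ, l₂ μ])).eval u = 0) := by
  set Q : ℂ[X] := hatB₂ ![l₁ μ, l₂ μ] with hQ
  have hQeval : ∀ v, Q.eval v = v ^ 4 + l₁ μ * v ^ 2 + l₂ μ := fun v => by rw [hQ, eval_hatB₂_eq]; rfl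
  have hVd : DifferentiableOn ℂ (fun v => U (μ, v)) (ball 0 ρ) :=
    hUd.comp ((differentiableOn_const _).prodMk differentiableOn_id) fun v hv => mk_mem_prod hμ hv
  have hg : ∀ v ∈ ball (0 : ℂ) ρ, f (μ, v) = Q.eval v * U (μ, v) := fun v hv => by
    rw [hfact (μ, v) (mk_mem_prod hμ hv), hQeval]
  have hderiv : deriv (fun v => f (μ, v)) u = (derivative Q).eval u * U (μ, u) + Q.eval u * deriv (fun v => U (μ, v)) u := by
    have hVu : HasDerivAt (fun v => U (μ, v)) (deriv (fun v => U (μ, v)) u) u :=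
      (hVd.differentiableAt (isOpen_ball.mem_nhds hu)).hasDerivAt
    have h := (Q.hasDerivAt u).mul hVu
    have h' : HasDerivAt (fun v => f (μ, v)) ((derivative Q).eval u * U (μ, u) + Q.eval u * deriv (fun v => U (μ, v)) u) u := by
      refine h.congr_of_eventuallyEq ?_
      filter_upwards [isOpen_ball.mem_nhds hu] with v hv
      exact hg v hv
    exact h'.deriv
  have hU0 : U (μ, u) ≠ 0 := hUne (μ, u) (mk_mem_prod hμ hu)
  constructor
  · rintro ⟨h0, h1⟩
    have hQ0 : Q.eval u = 0 := by
      rw [hg u hu] at h0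
      exact (mul_eq_zero.1 h0).resolve_right hU0
    refine ⟨hQ0, ?_⟩
    rw [hderiv, hQ0, zero_mul, add_zero] at h1
    exact (mul_eq_zero.1 h1).resolve_right hU0
  · rintro ⟨h0, h1⟩
    refine ⟨by rw [hg u hu, h0, zero_mul], ?_⟩
    rw [hderiv, h0, h1, zero_mul, zero_mul, add_zero]

/-- **Second `u`-derivative of `f(μ, ·)` at a critical zero** `u₀` in the disc: `∂ᵤ²f(μ, u₀) = F̂''(u₀)·U(μ, u₀)`.
[cite: ArnoldGuseinzadeVarchenko2012, Part I §5.2] -/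
theorem iteratedDeriv_two_eq_at_critical_zero (hUd : DifferentiableOn ℂ U (ball (0 : ℂ × ℂ) ε ×ˢ ball (0 : ℂ) ρ))
    (hfact : ∀ p ∈ ball (0 : ℂ × ℂ) ε ×ˢ ball (0 : ℂ) ρ, f p = (p.2 ^ 4 + l₁ p.1 * p.2 ^ 2 + l₂ p.1) * U p)
    {μ : ℂ × ℂ} (hμ : μ ∈ ball (0 : ℂ × ℂ) ε) {u₀ : ℂ} (hu₀ : u₀ ∈ ball (0 : ℂ) ρ)
    (hQ0 : (hatB₂ ![l₁ μ, l₂ μ]).eval u₀ = 0) (hQ1 : (derivative (hatB₂ ![l₁ μ, l₂ μ])).eval u₀ = 0) :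
    iteratedDeriv 2 (fun u => f (μ, u)) u₀ = (12 * u₀ ^ 2 + 2 * l₁ μ) * U (μ, u₀) := by
  have hVd : DifferentiableOn ℂ (fun v => U (μ, v)) (ball 0 ρ) :=
    hUd.comp ((differentiableOn_const _).prodMk differentiableOn_id) fun v hv => mk_mem_prod hμ hv
  have hg : ∀ v ∈ ball (0 : ℂ) ρ, f (μ, v) = (hatB₂ ![l₁ μ, l₂ μ]).eval v * U (μ, v) := fun v hv => by
    rw [hfact (μ, v) (mk_mem_prod hμ hv), eval_hatB₂_eq]; rfl
  rw [iteratedDeriv_two_eq_of_double_root isOpen_ball hVd hg hu₀ hQ0 hQ1, eval_derivative_derivative_hatB₂]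
  rfl

/-- **The axis branch: one critical zero, at `u = 0`, non-degenerate.**  In the situation of
`exists_even_quartic_preparation`, at a parameter `μ` with `λ₂(μ) = 0` (the branch `β = 0`) and `∂ᵤ²f(μ, 0) ≠ 0`:
`λ₁(μ) ≠ 0`, `μ` is NOT on the other branch (`4λ₂(μ) ≠ λ₁(μ)²`), and `u = 0` is the only critical zero of `f(μ, ·)` in
the disc (`F̂ = ŷ²(ŷ² + λ₁)`: the roots `ŷ² = -λ₁` are simple).  [cite: ArnoldGuseinzadeVarchenko2012, Part I §5.2 (held text chunks p0132–p0133)] -/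
theorem critical_zeros_axis (hρ : 0 < ρ) (hUd : DifferentiableOn ℂ U (ball (0 : ℂ × ℂ) ε ×ˢ ball (0 : ℂ) ρ))
    (hUne : ∀ p ∈ ball (0 : ℂ × ℂ) ε ×ˢ ball (0 : ℂ) ρ, U p ≠ 0)
    (hfact : ∀ p ∈ ball (0 : ℂ × ℂ) ε ×ˢ ball (0 : ℂ) ρ, f p = (p.2 ^ 4 + l₁ p.1 * p.2 ^ 2 + l₂ p.1) * U p)
    {μ : ℂ × ℂ} (hμ : μ ∈ ball (0 : ℂ × ℂ) ε) (hax : l₂ μ = 0) (hne : iteratedDeriv 2 (fun u => f (μ, u)) 0 ≠ 0) :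
    l₁ μ ≠ 0 ∧ ¬ (4 * l₂ μ = l₁ μ ^ 2) ∧
      ∀ u ∈ ball (0 : ℂ) ρ, (f (μ, u) = 0 ∧ deriv (fun u => f (μ, u)) u = 0) ↔ u = 0 := by
  have h0 : (0 : ℂ) ∈ ball (0 : ℂ) ρ := mem_ball_self hρ
  have hQ0 : (hatB₂ ![l₁ μ, l₂ μ]).eval 0 = 0 := by simp [eval_hatB₂_eq, hax]
  have hQ1 : (derivative (hatB₂ ![l₁ μ, l₂ μ])).eval 0 = 0 := by simp [eval_derivative_hatB₂]
  have h2 := iteratedDeriv_two_eq_at_critical_zero hUd hfact hμ h0 hQ0 hQ1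
  have hl₁ : l₁ μ ≠ 0 := by
    intro h
    rw [h2, h] at hne
    exact hne (by ring)
  refine ⟨hl₁, fun h => hl₁ (pow_eq_zero_iff two_ne_zero |>.1 (by rw [← h, hax, mul_zero])), fun u hu => ?_⟩
  rw [critical_zero_iff_hatB₂ hUd hUne hfact hμ hu, eval_hatB₂_eq, eval_derivative_hatB₂]
  simp only [Matrix.cons_val_zero, Matrix.cons_val_one, hax, add_zero]
  constructor
  · rintro ⟨hq, hq'⟩
    by_contra hu0
    have h3 : 2 * u ^ 2 + l₁ μ = 0 := by
      rcases mul_eq_zero.1 hq' with h | h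
      · exact absurd (by simpa using h) hu0
      · exact h
    have h4 : u ^ 2 * (u ^ 2 + l₁ μ) = 0 := by linear_combination hq
    rcases mul_eq_zero.1 h4 with h | h
    · exact hu0 (pow_eq_zero_iff two_ne_zero |>.1 h)
    · apply hl₁
      linear_combination 2 * h - h3
  · rintro rfl
    simp

/-- **The second branch: a symmetric pair `±u₀` of non-degenerate critical zeros.**  In the situation of
`exists_even_quartic_preparation`, at a parameter `μ` with `4λ₂(μ) = λ₁(μ)²` and `λ₂(μ) ≠ 0` (the branch `β = φ(α)`,
`β ≠ 0`): the critical zeros of `f(μ, ·)` in the disc are exactly `u₀` and `-u₀` for some `u₀ ≠ 0` (`u₀² = -λ₁/2`),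
and `∂ᵤ²f(μ, ±u₀) = -4λ₁(μ)·U ≠ 0`. [cite: ArnoldGuseinzadeVarchenko2012, Part I §5.2 fig. 48 (held text chunks p0132–p0133)] -/
theorem critical_zeros_branch (hUd : DifferentiableOn ℂ U (ball (0 : ℂ × ℂ) ε ×ˢ ball (0 : ℂ) ρ))
    (hUne : ∀ p ∈ ball (0 : ℂ × ℂ) ε ×ˢ ball (0 : ℂ) ρ, U p ≠ 0)
    (hfact : ∀ p ∈ ball (0 : ℂ × ℂ) ε ×ˢ ball (0 : ℂ) ρ, f p = (p.2 ^ 4 + l₁ p.1 * p.2 ^ 2 + l₂ p.1) * U p)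
    (hroots : ∀ μ ∈ ball (0 : ℂ × ℂ) ε, ∀ u : ℂ, u ^ 4 + l₁ μ * u ^ 2 + l₂ μ = 0 → u ∈ ball (0 : ℂ) ρ)
    {μ : ℂ × ℂ} (hμ : μ ∈ ball (0 : ℂ × ℂ) ε) (hbr : 4 * l₂ μ = l₁ μ ^ 2) (hl₂ : l₂ μ ≠ 0) :
    ∃ u₀ : ℂ, u₀ ≠ 0 ∧ u₀ ∈ ball (0 : ℂ) ρ ∧ -u₀ ∈ ball (0 : ℂ) ρ ∧
      (∀ u ∈ ball (0 : ℂ) ρ, (f (μ, u) = 0 ∧ deriv (fun u => f (μ, u)) u = 0) ↔ (u = u₀ ∨ u = -u₀)) ∧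
      iteratedDeriv 2 (fun u => f (μ, u)) u₀ ≠ 0 ∧ iteratedDeriv 2 (fun u => f (μ, u)) (-u₀) ≠ 0 := by
  have hl₁ : l₁ μ ≠ 0 := by
    intro h; apply hl₂
    have : 4 * l₂ μ = 0 := by rw [hbr, h]; ring
    linear_combination this / 4
  obtain ⟨u₀, hu₀⟩ := IsAlgClosed.exists_pow_nat_eq (-(l₁ μ) / 2) two_pos
  have hu₀ne : u₀ ≠ 0 := by
    rintro rfl
    apply hl₁
    have : -(l₁ μ) / 2 = 0 := by rw [← hu₀]; simp
    linear_combination -2 * this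
  -- `±u₀` are critical zeros of `F̂`
  have hcrit : ∀ u, u ^ 2 = -(l₁ μ) / 2 →
      (hatB₂ ![l₁ μ, l₂ μ]).eval u = 0 ∧ (derivative (hatB₂ ![l₁ μ, l₂ μ])).eval u = 0 := by
    intro u hu
    rw [eval_hatB₂_eq, eval_derivative_hatB₂]
    simp only [Matrix.cons_val_zero, Matrix.cons_val_one]
    constructor
    · have : u ^ 4 = (u ^ 2) ^ 2 := by ring
      rw [this, hu]
      linear_combination hbr / 4
    · rw [hu]; ring
  have hsq₀ : u₀ ^ 2 = -(l₁ μ) / 2 := hu₀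
  have hsq₁ : (-u₀) ^ 2 = -(l₁ μ) / 2 := by rw [neg_sq, hu₀]
  have hmem : ∀ u, u ^ 2 = -(l₁ μ) / 2 → u ∈ ball (0 : ℂ) ρ := fun u hu =>
    hroots μ hμ u (by
      have h := (hcrit u hu).1
      rw [eval_hatB₂_eq] at h
      simpa using h)
  have hsecond : ∀ u, u ^ 2 = -(l₁ μ) / 2 → iteratedDeriv 2 (fun u => f (μ, u)) u ≠ 0 := by
    intro u hu
    rw [iteratedDeriv_two_eq_at_critical_zero hUd hfact hμ (hmem u hu) (hcrit u hu).1 (hcrit u hu).2, hu]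
    have hU : U (μ, u) ≠ 0 := hUne (μ, u) (mk_mem_prod hμ (hmem u hu))
    have : (12 * (-l₁ μ / 2) + 2 * l₁ μ) = -4 * l₁ μ := by ring
    rw [this]
    exact mul_ne_zero (mul_ne_zero (by norm_num) hl₁) hU
  refine ⟨u₀, hu₀ne, hmem u₀ hsq₀, hmem (-u₀) hsq₁, fun u hu => ?_, hsecond u₀ hsq₀, hsecond (-u₀) hsq₁⟩
  rw [critical_zero_iff_hatB₂ hUd hUne hfact hμ hu]
  constructor
  · rintro ⟨hq, hq'⟩
    rw [eval_hatB₂_eq] at hq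
    rw [eval_derivative_hatB₂] at hq'
    simp only [Matrix.cons_val_zero, Matrix.cons_val_one] at hq hq'
    have hu0 : u ≠ 0 := by
      rintro rfl
      apply hl₂
      simpa using hq
    have h3 : 2 * u ^ 2 + l₁ μ = 0 := by
      rcases mul_eq_zero.1 hq' with h | h
      · exact absurd (by simpa using h) hu0
      · exact h
    have hsq : u ^ 2 = u₀ ^ 2 := by rw [hsq₀]; linear_combination h3 / 2
    exact sq_eq_sq_iff_eq_or_eq_neg.1 hsq
  · rintro (rfl | rfl)
    · exact hcrit _ hsq₀
    · exact hcrit _ hsq₁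

end BoundarySingularity

end Literature.Geometry.ComplexAnalytic

end
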